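import Summits.AtomisticToContinuum.Crystallization.Theorems.FrustratedLawDichotomyStrainedPatchHomEntryFitHcpSharp

/-!
# The sharp hcp fit verdict at fit threshold `η' = 4999/100000` (was `49/1000`): real fit theorem with general `η'`, kernel verdict `fitOKHSE`, soundness
# (27623 `(H) HomFloor (1/625)`, hcp half; critic row 1147 (c), pre-registered budget gate branch 3 «sharpen the inner leaf … a leaf swap, not a redesign»)

decomp-a2c hand-1 g30 (crux `AperiodicFrustratedLawGap`, stmt-AtomisticToContinuum-27623).  The kernel tolerance map of this generation
(`…HomEntryFitToleranceA/B`) shows that near the sheet crossover of the worst ray (`t ≈ 0.94 t_b`) the inner fit verdict `…HomEntryFitHcpSharpKit.fitOKHS`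
needs entry/shuffle half-width `2⁻¹⁴`, against `2^{-11.2}` in the BUDGET-F integrator, and the float decomposition attributes `.001` of the missing misfit margin
(`≈ .0037` for a perfect leaf at the crossover) to the verdict's threshold `49/1000`: the real fit theorem `…HomPrunesFit.goodAtScale_centre_of_fit_hcpPattern`
only requires `η' < η = 1/20`.  This file is the cheapest of the three sharpenings (threshold / rotation payload / centred enclosure):

* §1 ★★ `goodAtScale_of_fitBounds_hcp_eta` — `…HomEntryFitHcpKit.goodAtScale_of_fitBounds_hcp` VERBATIM with the constant `49/1000` replaced by a parameter
  `0 ≤ η' < 1/20` (def-free real theorem);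
* §2 ★ `fitOKHSE c w` — `fitOKHS` verbatim except the pair test `10¹⁰ · misMax ≤ 24990001 · d2S` (`(4999/100000)²`);
* §3 ★★ `fitOKHSE_sound` — `…HomEntryFitHcpSharp.fitOKHS_sound` verbatim through §1 (same conclusion shape, so every consumer of `fitOKHS` can take `fitOKHSE`).
The sequel `…HomEntryFitHcpSharpEtaLeaf` plugs it into the quick verdict / the slab leaf `entryLeafOKHT4` and records the kernel gain at the crossover.

One definition (`fitOKHSE`, computable); 0 sorry; standard axioms; no instances / notation / `#eval`.  `--supports stmt-AtomisticToContinuum-27623`.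
-/

namespace Summit.AtomisticToContinuum.Crystallization.Theorems.FrustratedLawDichotomyStrainedPatchHomEntryFitHcpSharpEta

open scoped BigOperators RealInnerProductSpace
open Literature.Analysis.ValidatedNumerics.Numerics
open Literature.Geometry.DiscreteGeometry (hcpKissingPattern)
open Literature.Geometry.DiscreteGeometry.ShellCensus (hcpTuple hcpTuple_injective)
open Summit.AtomisticToContinuum.Crystallization.Theorems.ChargedEnergyGapNegative (E3)
open Summit.AtomisticToContinuum.Crystallization.Theorems.FrustratedLawDichotomySchurCut (effPot w₄₅ ω₄)
open Summit.AtomisticToContinuum.Crystallization.Theorems.FrustratedLawDichotomyMotifLemmas (GoodAtScale)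
open Summit.AtomisticToContinuum.Crystallization.Theorems.FrustratedLawDichotomyAveragingRuleTightFree (TightNearCap BadNearCap)
open Summit.AtomisticToContinuum.Crystallization.Theorems.FrustratedLawDichotomyExemptAbsorption (ExemptNear)
open Summit.AtomisticToContinuum.Crystallization.Theorems.FrustratedLawDichotomyStrainedPatchHomSplit
open Summit.AtomisticToContinuum.Crystallization.Theorems.FrustratedLawDichotomyStrainedPatchHomGram (norm_sq_latPt_eq_sum_gram norm_sq_latPt_add_eq_sum_gram)
open Summit.AtomisticToContinuum.Crystallization.Theorems.FrustratedLawDichotomyStrainedPatchHomLatticeBox (norm_apply_ge_of_near_one latPt_zero)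
open Summit.AtomisticToContinuum.Crystallization.Theorems.FrustratedLawDichotomyStrainedPatchHomLatticeBoxHcp
  (latPt_eq_apply_one shifted_eq_apply mem_box_of_norm_hexPt_lt mem_box_of_norm_hexPt_add_shift_lt)
open Summit.AtomisticToContinuum.Crystallization.Theorems.FrustratedLawDichotomyStrainedPatchHomPrunesFit (goodAtScale_centre_of_fit_hcpPattern)
open Summit.AtomisticToContinuum.Crystallization.Theorems.FrustratedLawDichotomyAveragingCut (self_mem_ball)
open Summit.AtomisticToContinuum.Crystallization.Theorems.FrustratedLawDichotomyStrainedPatchHomPrunes (locHom_hcp_centre)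
open Summit.AtomisticToContinuum.Crystallization.Theorems.FrustratedLawDichotomyStrainedPatchHomPrunedPolar (homFloor_of_prunedBoxSums_selfAdjoint)
open Summit.AtomisticToContinuum.Crystallization.Theorems.FrustratedLawDichotomyStrainedPatchHomLeafCheckC (iccC iccC_eq)
open Summit.AtomisticToContinuum.Crystallization.Theorems.FrustratedLawDichotomyStrainedPatchHomCertTree (CertTree treeOK)
open Summit.AtomisticToContinuum.Crystallization.Theorems.FrustratedLawDichotomyStrainedPatchHomEntryGram
open Summit.AtomisticToContinuum.Crystallization.Theorems.FrustratedLawDichotomyStrainedPatchHomEntryFitKit (lmin lmin_le_of_mem lmin_mem)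
open Summit.AtomisticToContinuum.Crystallization.Theorems.FrustratedLawDichotomyStrainedPatchHomEntryFit (scaleL devFI entryLeafOKF fccHalf_of_entryFitTree lmax le_lmax_of_mem)
open Summit.AtomisticToContinuum.Crystallization.Theorems.FrustratedLawDichotomyStrainedPatchHomEntryGramHcp
open Summit.AtomisticToContinuum.Crystallization.Theorems.FrustratedLawDichotomyStrainedPatchHomEntryHcpFrame
open Summit.AtomisticToContinuum.Crystallization.Theorems.FrustratedLawDichotomyTwoShellRigidityAssemblyDial (hcpTuple_mem exists_hcpTuple_eq)
open Summit.AtomisticToContinuum.Crystallization.Theorems.FrustratedLawDichotomyStrainedPatchHomLatticeBoxHcp (latPt_eq_apply_one)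
open Summit.AtomisticToContinuum.Crystallization.Theorems.FrustratedLawDichotomyStrainedPatchHomEntryFit (scaleL devFI lmax le_lmax_of_mem)
open Summit.AtomisticToContinuum.Crystallization.Theorems.FrustratedLawDichotomyStrainedPatchHomEntryFitHcpKit
open Summit.AtomisticToContinuum.Crystallization.Theorems.FrustratedLawDichotomyStrainedPatchHomEntryFitHcp
open Summit.AtomisticToContinuum.Crystallization.Theorems.FrustratedLawDichotomyStrainedPatchHomEntrySearch
open Summit.AtomisticToContinuum.Crystallization.Theorems.FrustratedLawDichotomyStrainedPatchHomEntrySign (entryLeafOKD fccHalf_of_entrySearchDom)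
open Summit.AtomisticToContinuum.Crystallization.Theorems.FrustratedLawDichotomyStrainedPatchHomEntryFitHcpSharpKit
open Summit.AtomisticToContinuum.Crystallization.Theorems.FrustratedLawDichotomyStrainedPatchHomEntryFitHcpSharp

/-! ## §1. The real fit theorem with a general threshold -/

/-- ★★ **CENTRE `1/20`-GOOD (hcp PATTERN) FROM FIT BOUNDS, GENERAL FIT THRESHOLD `η' < 1/20`** (def-free; verbatim
`…HomEntryFitHcpKit.goodAtScale_of_fitBounds_hcp` with the constant `49/1000` replaced by a parameter). [folklore] -/
theorem goodAtScale_of_fitBounds_hcp_eta (U : E3 →L[ℝ] E3) (ξ : E3) (hU : ‖U - 1‖ ≤ 1 / 4) (hξ : ‖ξ‖ ≤ 1 / 2) {η' : ℝ} (hη'0 : 0 ≤ η')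
    (hη' : η' < 1 / 20) {dlo dhi : ℝ} (hdlo : 0 < dlo)
    (hdhi : dhi ≤ 3 / 2)
    (hlo : ∀ k, dlo ≤ ‖nbrU U ξ k‖) (hhi : ∃ k, ‖nbrU U ξ k‖ ≤ dhi) {d2lo : ℝ} (hd2 : ∀ k, d2lo ≤ ‖nbrU U ξ k‖ ^ 2)
    (hfit : ∀ k k', ‖nbrU U ξ k - ‖nbrU U ξ k'‖ • nbr k‖ ^ 2 ≤ η' ^ 2 * d2lo)
    (hcl : ∀ k, ‖nbrU U ξ k‖ ≤ 13 / 10 * dlo - 1 / 100)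
    (hfarA : ∀ b ∈ (Fintype.piFinset fun _ : Fin 3 => Finset.Icc (-7 : ℤ) 7), b ≠ 0 → (∀ k, hshift k = false → hlab k ≠ b) →
      13 / 10 * dhi + 1 / 100 ≤ ‖latPt U hexFrame b‖)
    (hfarB : ∀ b ∈ (Fintype.piFinset fun _ : Fin 3 => Finset.Icc (-7 : ℤ) 7), (∀ k, hshift k = true → hlab k ≠ b) →
      13 / 10 * dhi + 1 / 100 ≤ ‖latPt U hexFrame b + U (hcpShift + ξ)‖) :
    ∀ (M : ℕ) (z : Fin M → E3) (c : Fin M), Function.Injective z →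
      (∀ x : E3, dist x (z c) < 15 / 2 → (x ∈ Set.range z ↔
        x - z c ∈ {v : E3 | ∃ b : Fin 3 → ℤ, v = latPt U hexFrame b ∨ v = latPt U hexFrame b + U (hcpShift + ξ)})) →
      GoodAtScale (1 / 20) (3 / 2) z c := by
  intro M z c _hz hT
  obtain ⟨k₀, -, hk₀⟩ := Finset.exists_min_image Finset.univ (fun k : Fin 12 => ‖nbrU U ξ k‖) Finset.univ_nonempty
  have hd_le : ∀ k, ‖nbrU U ξ k₀‖ ≤ ‖nbrU U ξ k‖ := fun k => hk₀ k (Finset.mem_univ k)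
  have hdlo_d : dlo ≤ ‖nbrU U ξ k₀‖ := hlo k₀
  have hd_dhi : ‖nbrU U ξ k₀‖ ≤ dhi := by obtain ⟨k, hk⟩ := hhi; exact (hd_le k).trans hk
  have hd0 : 0 < ‖nbrU U ξ k₀‖ := hdlo.trans_le hdlo_d
  obtain ⟨A, hA⟩ := exists_hcpIso
  -- the index of a pattern point
  have hk : ∀ u : ↥hcpKissingPattern, ∃ k : Fin 12, hcpTuple k = (u : E3) := fun u => exists_hcpTuple_eq u.2
  choose kOf hkOf using hk
  -- both families are short only on the twelve labels
  have hshortA : ∀ b : Fin 3 → ℤ, latPt U hexFrame b ≠ 0 → ‖latPt U hexFrame b‖ < 13 / 10 * ‖nbrU U ξ k₀‖ + 1 / 100 →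
      ∃ k, hshift k = false ∧ hlab k = b := by
    intro b hb0 hlt
    by_cases hex : ∃ k, hshift k = false ∧ hlab k = b
    · exact hex
    · exfalso
      have hb : b ≠ 0 := by rintro rfl; exact hb0 (latPt_zero U hexFrame)
      have h34 := norm_apply_ge_of_near_one hU (latPt 1 hexFrame b)
      rw [← latPt_eq_apply_one] at h34
      have hbox := mem_box_of_norm_hexPt_lt (b := b) (by linarith)
      have := hfarA b hbox hb (fun k hk he => hex ⟨k, hk, he⟩)
      linarith
  have hshortB : ∀ b : Fin 3 → ℤ, ‖latPt U hexFrame b + U (hcpShift + ξ)‖ < 13 / 10 * ‖nbrU U ξ k₀‖ + 1 / 100 →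
      ∃ k, hshift k = true ∧ hlab k = b := by
    intro b hlt
    by_cases hex : ∃ k, hshift k = true ∧ hlab k = b
    · exact hex
    · exfalso
      have h34 := norm_apply_ge_of_near_one hU (latPt 1 hexFrame b + hcpShift + ξ)
      rw [← shifted_eq_apply] at h34
      have htri : ‖latPt 1 hexFrame b + hcpShift‖ ≤ ‖latPt 1 hexFrame b + hcpShift + ξ‖ + ‖ξ‖ := by
        have := norm_sub_le (latPt 1 hexFrame b + hcpShift + ξ) ξ
        simpa using this
      have hbox := mem_box_of_norm_hexPt_add_shift_lt (b := b) (by linarith)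
      have := hfarB b hbox (fun k hk he => hex ⟨k, hk, he⟩)
      linarith
  refine goodAtScale_centre_of_fit_hcpPattern hT (d := ‖nbrU U ξ k₀‖) (η' := η') (γ := 1 / 100) (A := A)
    (t' := fun u => nbrU U ξ (kOf u)) (hd_dhi.trans hdhi) hd0 (by norm_num) hη' (by linarith) ?_ ?_ ?_ ?_
  · -- (hfit)
    intro u
    refine ⟨nbrU_mem U ξ (kOf u), by linarith [hcl (kOf u), hlo (kOf u)], ?_⟩
    have g := hfit (kOf u) k₀
    have h2 := hd2 k₀
    have hsq : ‖nbrU U ξ (kOf u) - ‖nbrU U ξ k₀‖ • nbr (kOf u)‖ ^ 2 ≤ (η' * ‖nbrU U ξ k₀‖) ^ 2 := by rw [mul_pow]; nlinarith [sq_nonneg η']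
    show ‖nbrU U ξ (kOf u) - ‖nbrU U ξ k₀‖ • A (u : E3)‖ ≤ η' * ‖nbrU U ξ k₀‖
    rw [← hkOf u, hA]
    exact (abs_le_of_sq_le_sq' hsq (mul_nonneg hη'0 (norm_nonneg _))).2
  · -- (hlow)
    rintro w ⟨b, hb⟩ hw0 hlt
    rcases hb with rfl | rfl
    · obtain ⟨k, hk, rfl⟩ := hshortA b hw0 hlt
      rw [← nbrU_of_unshifted (U := U) (ξ := ξ) hk]; exact hd_le k
    · obtain ⟨k, hk, rfl⟩ := hshortB b hlt
      rw [← nbrU_of_shifted (U := U) (ξ := ξ) hk]; exact hd_le k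
  · -- (hex)
    refine ⟨nbrU U ξ k₀, nbrU_mem U ξ k₀, fun h0 => ?_, le_rfl⟩
    rw [h0, norm_zero] at hd0
    exact lt_irrefl _ hd0
  · -- (hclean)
    rintro w ⟨b, hb⟩ hw0 hlt
    have key : ∀ k, w = nbrU U ξ k → ‖w‖ ≤ 13 / 10 * ‖nbrU U ξ k₀‖ - 1 / 100 ∧ w ∈ Set.range (fun u : ↥hcpKissingPattern => nbrU U ξ (kOf u)) := by
      rintro k rfl
      refine ⟨by linarith [hcl k], ⟨⟨hcpTuple k, hcpTuple_mem k⟩, ?_⟩⟩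
      have e : kOf ⟨hcpTuple k, hcpTuple_mem k⟩ = k := hcpTuple_injective (hkOf ⟨hcpTuple k, hcpTuple_mem k⟩)
      simp only [e]
    rcases hb with rfl | rfl
    · obtain ⟨k, hk, rfl⟩ := hshortA b hw0 hlt
      exact key k (nbrU_of_unshifted hk).symm
    · obtain ⟨k, hk, rfl⟩ := hshortB b hlt
      exact key k (nbrU_of_shifted hk).symm

/-! ## §2. The kernel verdict at `η' = 4999/100000` -/

/-- ★ **THE SHARP hcp (P1) FIT VERDICT AT THRESHOLD `η' = 4999/100000`**: `…HomEntryFitHcpSharpKit.fitOKHS` verbatim except the pair test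
`10¹⁰ · misMax ≤ 24990001 · d2S` (misfit `≤ (4999/100000)² d²` instead of `(49/1000)² d²`). -/
def fitOKHSE (c w : (Fin 3 × Fin 3) ⊕ Fin 3 → ℤ) : Bool :=
  let L := scaleL (fun ab => c (Sum.inl ab))
  let D := dEnclH c w
  decide (0 ≤ L) && decide (0 < D.lo) && decide (D.lo ≤ D.hi) && decide (2 * D.hi ≤ 3 * (SC : ℤ)) &&
  decide ((SC : ℤ) ≤ 130 * D.lo) && decide (4 * (xiSq c w).hi ≤ (SC : ℤ)) &&
  decide (10000000000 * misMax c w L ≤ 24990001 * d2S c w L) &&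
  K12H.all (fun k => decide ((nbrSq c w k).hi * SC * 10000 ≤ (130 * D.lo - SC) ^ 2)) &&
  decide (∀ b ∈ box7all,
    (b = 0 ∨ (∃ k : Fin 12, hshift k = false ∧ hlab k = b) ∨ (130 * D.hi + (SC : ℤ)) ^ 2 ≤ (qform13 (extU c w) b false).lo * SC * 10000) ∧
    ((∃ k : Fin 12, hshift k = true ∧ hlab k = b) ∨ (130 * D.hi + (SC : ℤ)) ^ 2 ≤ (qform13 (extU c w) b true).lo * SC * 10000))

/-! ## §3. Soundness -/

/-- ★★ **SOUNDNESS OF `fitOKHSE`** (same conclusion shape as `…HomEntryFitHcpSharp.fitOKHS_sound`; proof verbatim with the threshold `4999/100000`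
through `goodAtScale_of_fitBounds_hcp_eta`). [folklore] -/
theorem fitOKHSE_sound {c w : (Fin 3 × Fin 3) ⊕ Fin 3 → ℤ} (h : fitOKHSE c w = true) (U : E3 →L[ℝ] E3) (ξ : E3) (hU : ‖U - 1‖ ≤ 1 / 4)
    (hbox : ∀ ab : Fin 3 × Fin 3, |(U (EuclideanSpace.single ab.2 (1 : ℝ))) ab.1 - (c (Sum.inl ab) : ℝ) / SC| ≤ (w (Sum.inl ab) : ℝ) / SC)
    (hξb : ∀ i : Fin 3, |ξ i - (c (Sum.inr i) : ℝ) / SC| ≤ (w (Sum.inr i) : ℝ) / SC) :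
    ∀ (M : ℕ) (z : Fin M → E3) (c : Fin M), Function.Injective z →
      Set.range z = {x : E3 | dist x (z c) ≤ 133 / 10 ∧ ∃ a : Fin 3 → ℤ,
        x = z c + latPt U hexFrame a ∨ x = z c + latPt U hexFrame a + U (hcpShift + ξ)} →
      TightNearCap (9 / 5) (3 / 2) z c ∨ ExemptNear (9 / 5) ExRec z c ∨ BadNearCap (9 / 5) (3 / 2) z c := by
  simp only [fitOKHSE, Bool.and_eq_true, decide_eq_true_eq, List.all_eq_true] at h
  obtain ⟨⟨⟨⟨⟨⟨⟨⟨hL0, h0⟩, h01⟩, h32⟩, h130⟩, hxi4⟩, hfitZ⟩, hK⟩, hfar⟩ := h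
  have hS := SC_pos
  have hne := SC_ne
  set cU : Fin 3 × Fin 3 → ℤ := fun ab => c (Sum.inl ab) with hcU
  set lam : ℝ := (scaleL cU : ℝ) / SC with hlam
  have hlam0 : 0 ≤ lam := div_nonneg (by exact_mod_cast hL0) hS.le
  set V : E3 →L[ℝ] E3 := U - lam • (1 : E3 →L[ℝ] E3) with hVdef
  have hV : ∀ x : E3, U x = lam • x + V x := fun x => by
    have : V x = U x - lam • x := by simp [hVdef]
    rw [this]; abel
  -- enclosures of the extended Gram data of `U`, of the deviation entries and of the shuffle
  have hE : ∀ ab : Fin 3 × Fin 3, FI.mem ((U (EuclideanSpace.single ab.2 (1 : ℝ))) ab.1) (entU c w ab) := fun ab => mem_entryFI (hbox ab)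
  have hE' : ∀ ab : Fin 3 × Fin 3, FI.mem ((V (EuclideanSpace.single ab.2 (1 : ℝ))) ab.1) (devH c w (scaleL cU) ab) :=
    FrustratedLawDichotomyStrainedPatchHomEntryFit.mem_devFI U (scaleL cU) hbox
  have hX : ∀ i, FI.mem (ξ i) (shufFI c w i) := fun i => mem_shufFI (hξb i)
  have hLm : FI.mem lam (FI.ofScaled (scaleL cU)) := FI.mem_ofScaled _
  obtain ⟨hUG, hUC, hUT⟩ : (∀ i j, FI.mem ⟪U (hexFrame i), U (hexFrame j)⟫ (extU c w (Sum.inl (i, j)))) ∧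
      (∀ i, FI.mem ⟪U (hexFrame i), U (hcpShift + ξ)⟫ (extU c w (Sum.inr (Sum.inl i)))) ∧
      FI.mem (‖U (hcpShift + ξ)‖ ^ 2) (extU c w (Sum.inr (Sum.inr 0))) := mem_extFI U ξ hE hX
  -- per label: ‖nbrU k‖² (Gram form, for `d`) and the sharp data
  have hnbr : ∀ k, FI.mem (‖nbrU U ξ k‖ ^ 2) (nbrSq c w k) := fun k => by
    have := mem_qform13 U (hcpShift + ξ) hUG hUC hUT (hlab k) (hshift k)
    unfold nbrU nbrSq; exact this
  set R : Fin 12 → E3 := fun k => rReal V ξ lam k with hRdef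
  have hdk : ∀ k, nbrU U ξ k = lam • nbr k + R k := fun k => nbrU_eq_smul_add_rReal hV ξ k
  have hRm : ∀ k a, FI.mem ((R k) a) (rVec (devH c w (scaleL cU)) (shufFI c w) (FI.ofScaled (scaleL cU)) k a) := fun k a =>
    mem_rVec V ξ hE' hX hLm k a
  have hP : ∀ k, FI.mem ⟪R k, nbr k⟫ (rP (devH c w (scaleL cU)) (shufFI c w) (FI.ofScaled (scaleL cU)) k) := fun k =>
    mem_dot3 (hRm k) (mem_nbrFI k)
  have hQ : ∀ k, FI.mem (‖R k‖ ^ 2) (rSq (devH c w (scaleL cU)) (shufFI c w) (FI.ofScaled (scaleL cU)) k) := fun k => by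
    rw [← real_inner_self_eq_norm_sq]; exact mem_dot3 (hRm k) (hRm k)
  have hN : ∀ k, FI.mem (‖nbrU U ξ k‖ ^ 2) (nrm2 (devH c w (scaleL cU)) (shufFI c w) (FI.ofScaled (scaleL cU)) k) := fun k => by
    have e : ‖nbrU U ξ k‖ ^ 2 = (lam ^ 2 + lam * ⟪R k, nbr k⟫ * ((2 : ℤ) : ℝ)) + ‖R k‖ ^ 2 := by
      rw [hdk, norm_add_sq_real, norm_smul, Real.norm_eq_abs, abs_of_nonneg hlam0, norm_nbr, mul_one, real_inner_smul_left,
        real_inner_comm]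
      push_cast; ring
    rw [e]
    exact FI.mem_add (FI.mem_add (FI.mem_sqr hLm) (FI.mem_mulInt (FI.mem_mul hLm (hP k)) 2)) (hQ k)
  have hD : ∀ k, FI.mem (‖nbrU U ξ k‖ - lam) (dlt (devH c w (scaleL cU)) (shufFI c w) (FI.ofScaled (scaleL cU)) k) := fun k => by
    have := FI.mem_sqrt (hN k)
    rw [Real.sqrt_sq (norm_nonneg _)] at this
    exact FI.mem_sub this hLm
  have hMis : ∀ k k', FI.mem (‖nbrU U ξ k - ‖nbrU U ξ k'‖ • nbr k‖ ^ 2)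
      (mis (devH c w (scaleL cU)) (shufFI c w) (FI.ofScaled (scaleL cU)) k k') := fun k k' => by
    have hsplit : nbrU U ξ k - ‖nbrU U ξ k'‖ • nbr k = R k - (‖nbrU U ξ k'‖ - lam) • nbr k := by
      rw [hdk, sub_smul]; abel
    have e : ‖nbrU U ξ k - ‖nbrU U ξ k'‖ • nbr k‖ ^ 2 =
        (‖R k‖ ^ 2 - (‖nbrU U ξ k'‖ - lam) * ⟪R k, nbr k⟫ * ((2 : ℤ) : ℝ)) + (‖nbrU U ξ k'‖ - lam) ^ 2 := by
      rw [hsplit, norm_sub_sq_real, norm_smul, Real.norm_eq_abs, norm_nbr, mul_one, sq_abs, real_inner_smul_right]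
      push_cast; ring
    rw [e]
    exact FI.mem_add (FI.mem_sub (hQ k) (FI.mem_mulInt (FI.mem_mul (hD k') (hP k)) 2)) (FI.mem_sqr (hD k'))
  -- `‖ξ‖ ≤ 1/2`
  have hxi : FI.mem (‖ξ‖ ^ 2) (xiSq c w) := by
    rw [EuclideanSpace.norm_sq_eq, Fin.sum_univ_three]
    simp only [Real.norm_eq_abs, sq_abs]
    exact FI.mem_add (FI.mem_add (FI.mem_sqr (hX 0)) (FI.mem_sqr (hX 1))) (FI.mem_sqr (hX 2))
  have hξ2 : ‖ξ‖ ≤ 1 / 2 := by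
    have h1 := (FI.mem_def.1 hxi).2
    have h2 : (4 : ℝ) * (xiSq c w).hi ≤ SC := by exact_mod_cast hxi4
    have h3 : ‖ξ‖ ^ 2 * SC * 4 ≤ SC * 1 := by linarith
    have hsq : ‖ξ‖ ^ 2 ≤ (1 / 2) ^ 2 := by
      have := le_of_mul_le_mul_right (by linarith : ‖ξ‖ ^ 2 * 4 * SC ≤ 1 * SC) hS
      linarith
    exact (abs_le_of_sq_le_sq' hsq (by norm_num)).2
  -- the minimum and its enclosures
  obtain ⟨k₀, -, hk₀⟩ := Finset.exists_min_image Finset.univ (fun k : Fin 12 => ‖nbrU U ξ k‖) Finset.univ_nonempty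
  have hd_le : ∀ k, ‖nbrU U ξ k₀‖ ≤ ‖nbrU U ξ k‖ := fun k => hk₀ k (Finset.mem_univ k)
  have hd0 : 0 ≤ ‖nbrU U ξ k₀‖ := norm_nonneg _
  have hDsq_lo : ∀ k, ((dSqH c w).lo : ℝ) ≤ ‖nbrU U ξ k‖ ^ 2 * SC := fun k => by
    have h1 : lmin (K12H.map fun k => (nbrSq c w k).lo) ≤ (nbrSq c w k).lo := lmin_le_of_mem _ _ (List.mem_map.2 ⟨k, mem_K12H k, rfl⟩)
    have h1' : ((lmin (K12H.map fun k => (nbrSq c w k).lo) : ℤ) : ℝ) ≤ (nbrSq c w k).lo := by exact_mod_cast h1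
    exact h1'.trans (FI.mem_def.1 (hnbr k)).1
  have hmemDsq : FI.mem (‖nbrU U ξ k₀‖ ^ 2) (dSqH c w) := by
    refine ⟨hDsq_lo k₀, ?_⟩
    have hl : (K12H.map fun k => (nbrSq c w k).hi) ≠ [] := by simp [K12H]
    obtain ⟨k', _, he⟩ := List.mem_map.1 (lmin_mem _ hl)
    have h2 := (FI.mem_def.1 (hnbr k')).2
    have hle := mul_le_mul_of_nonneg_right (pow_le_pow_left₀ hd0 (hd_le k') 2) hS.le
    show ‖nbrU U ξ k₀‖ ^ 2 * SC ≤ (((dSqH c w).hi : ℤ) : ℝ)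
    rw [show (dSqH c w).hi = lmin (K12H.map fun k => (nbrSq c w k).hi) from rfl, ← he]
    linarith
  have hmemD : FI.mem ‖nbrU U ξ k₀‖ (dEnclH c w) := by
    have := FI.mem_sqrt hmemDsq
    rwa [Real.sqrt_sq hd0] at this
  obtain ⟨hDlo, hDhi⟩ := FI.mem_def.1 hmemD
  have h0' : (0 : ℝ) < (dEnclH c w).lo := by exact_mod_cast h0
  -- the sharp `d²` lower end
  have hd2S : ∀ k, ((d2S c w (scaleL cU) : ℤ) : ℝ) ≤ ‖nbrU U ξ k‖ ^ 2 * SC := fun k => by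
    have h1 : d2S c w (scaleL cU) ≤ (nrm2 (devH c w (scaleL cU)) (shufFI c w) (FI.ofScaled (scaleL cU)) k).lo :=
      lmin_le_of_mem _ _ (List.mem_map.2 ⟨k, mem_K12H k, rfl⟩)
    have h1' : ((d2S c w (scaleL cU) : ℤ) : ℝ) ≤ (nrm2 (devH c w (scaleL cU)) (shufFI c w) (FI.ofScaled (scaleL cU)) k).lo := by
      exact_mod_cast h1
    exact h1'.trans (FI.mem_def.1 (hN k)).1
  refine fun M z j hz hrange => Or.inl ⟨j, self_mem_ball (by norm_num) z j,
    goodAtScale_of_fitBounds_hcp_eta U ξ hU hξ2 (η' := 4999 / 100000) (by norm_num) (by norm_num) (dlo := ((dEnclH c w).lo : ℝ) / SC) (dhi := ((dEnclH c w).hi : ℝ) / SC)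
      (d2lo := ((d2S c w (scaleL cU) : ℤ) : ℝ) / SC) (div_pos h0' hS) ?_ ?_ ?_ ?_ ?_ ?_ ?_ ?_ M z j hz (locHom_hcp_centre hrange)⟩
  · -- dhi ≤ 3/2
    rw [div_le_iff₀ hS]
    have : (2 : ℝ) * (dEnclH c w).hi ≤ 3 * SC := by exact_mod_cast h32
    linarith
  · -- (d) lower
    intro k
    have := mul_le_mul_of_nonneg_right (hd_le k) hS.le
    rw [div_le_iff₀ hS]
    linarith
  · -- (d) upper
    exact ⟨k₀, by rw [le_div_iff₀ hS]; exact hDhi⟩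
  · -- d2lo
    intro k
    rw [div_le_iff₀ hS]
    exact hd2S k
  · -- (F1) SHARP fit: the pair misfit enclosure against the kernel bound
    intro k k'
    have hm := (FI.mem_def.1 (hMis k k')).2
    have hle : (mis (devH c w (scaleL cU)) (shufFI c w) (FI.ofScaled (scaleL cU)) k k').hi ≤ misMax c w (scaleL cU) :=
      le_lmax_of_mem _ _ (List.mem_flatMap.2 ⟨k, mem_K12H k, List.mem_map.2 ⟨k', mem_K12H k', rfl⟩⟩)
    have hle' : ((mis (devH c w (scaleL cU)) (shufFI c w) (FI.ofScaled (scaleL cU)) k k').hi : ℝ) ≤ misMax c w (scaleL cU) := by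
      exact_mod_cast hle
    have hfitR : (10000000000 : ℝ) * misMax c w (scaleL cU) ≤ 24990001 * d2S c w (scaleL cU) := by exact_mod_cast hfitZ
    rw [show (4999 / 100000 : ℝ) ^ 2 * (((d2S c w (scaleL cU) : ℤ) : ℝ) / SC) = 24990001 * ((d2S c w (scaleL cU) : ℤ) : ℝ) / (10000000000 * SC) by ring,
      le_div_iff₀ (by positivity)]
    have h6 := mul_le_mul_of_nonneg_left (hm.trans hle') (by norm_num : (0 : ℝ) ≤ 10000000000)
    linarith
  · -- (F2) clean gap
    intro k
    have f3 := hK k (mem_K12H k)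
    have hC := (FI.mem_def.1 (hnbr k)).2
    have f3' : ((nbrSq c w k).hi : ℝ) * SC * 10000 ≤ (130 * (dEnclH c w).lo - SC) ^ 2 := by exact_mod_cast f3
    have h130' : (SC : ℝ) ≤ 130 * (dEnclH c w).lo := by exact_mod_cast h130
    have hC' := mul_le_mul_of_nonneg_right hC (by positivity : (0 : ℝ) ≤ SC * 10000)
    have hsq : (‖nbrU U ξ k‖ * (100 * SC)) ^ 2 ≤ ((130 : ℝ) * (dEnclH c w).lo - SC) ^ 2 := by
      have e : (‖nbrU U ξ k‖ * (100 * SC)) ^ 2 = ‖nbrU U ξ k‖ ^ 2 * SC * (SC * 10000) := by ring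
      rw [e]; linarith
    have hle := (abs_le_of_sq_le_sq' hsq (by linarith)).2
    rw [show (13 : ℝ) / 10 * (((dEnclH c w).lo : ℝ) / SC) - 1 / 100 = (130 * ((dEnclH c w).lo : ℝ) - SC) / (100 * SC) by field_simp; ring,
      le_div_iff₀ (by positivity)]
    exact hle
  · -- (F3) far, family A
    intro b hb hb0 hnot
    rw [← box7all_eq] at hb
    obtain ⟨hA, _⟩ := hfar b hb
    rcases hA with rfl | ⟨k, hk, he⟩ | f4
    · exact (hb0 rfl).elim
    · exact (hnot k hk he).elim
    · have f4' : ((130 : ℝ) * (dEnclH c w).hi + SC) ^ 2 ≤ ((qform13 (extU c w) b false).lo : ℝ) * SC * 10000 := by exact_mod_cast f4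
      have hm := mem_qform13 U (hcpShift + ξ) hUG hUC hUT b false
      simp only [Bool.false_eq_true, ↓reduceIte, add_zero] at hm
      have hC := (FI.mem_def.1 hm).1
      have hC' := mul_le_mul_of_nonneg_right hC (by positivity : (0 : ℝ) ≤ SC * 10000)
      have hsq : ((130 : ℝ) * (dEnclH c w).hi + SC) ^ 2 ≤ (‖latPt U hexFrame b‖ * (100 * SC)) ^ 2 := by
        have e : (‖latPt U hexFrame b‖ * (100 * SC)) ^ 2 = ‖latPt U hexFrame b‖ ^ 2 * SC * (SC * 10000) := by ring
        rw [e]; linarith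
      have hle := (abs_le_of_sq_le_sq' hsq (by positivity)).2
      rw [show (13 : ℝ) / 10 * (((dEnclH c w).hi : ℝ) / SC) + 1 / 100 = (130 * ((dEnclH c w).hi : ℝ) + SC) / (100 * SC) by field_simp; ring,
        div_le_iff₀ (by positivity)]
      exact hle
  · -- (F3) far, family B
    intro b hb hnot
    rw [← box7all_eq] at hb
    obtain ⟨_, hB⟩ := hfar b hb
    rcases hB with ⟨k, hk, he⟩ | f4
    · exact (hnot k hk he).elim
    · have f4' : ((130 : ℝ) * (dEnclH c w).hi + SC) ^ 2 ≤ ((qform13 (extU c w) b true).lo : ℝ) * SC * 10000 := by exact_mod_cast f4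
      have hm := mem_qform13 U (hcpShift + ξ) hUG hUC hUT b true
      simp only [↓reduceIte] at hm
      have hC := (FI.mem_def.1 hm).1
      have hC' := mul_le_mul_of_nonneg_right hC (by positivity : (0 : ℝ) ≤ SC * 10000)
      have hsq : ((130 : ℝ) * (dEnclH c w).hi + SC) ^ 2 ≤ (‖latPt U hexFrame b + U (hcpShift + ξ)‖ * (100 * SC)) ^ 2 := by
        have e : (‖latPt U hexFrame b + U (hcpShift + ξ)‖ * (100 * SC)) ^ 2 = ‖latPt U hexFrame b + U (hcpShift + ξ)‖ ^ 2 * SC * (SC * 10000) := by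
          ring
        rw [e]; linarith
      have hle := (abs_le_of_sq_le_sq' hsq (by positivity)).2
      rw [show (13 : ℝ) / 10 * (((dEnclH c w).hi : ℝ) / SC) + 1 / 100 = (130 * ((dEnclH c w).hi : ℝ) + SC) / (100 * SC) by field_simp; ring,
        div_le_iff₀ (by positivity)]
      exact hle

end Summit.AtomisticToContinuum.Crystallization.Theorems.FrustratedLawDichotomyStrainedPatchHomEntryFitHcpSharpEta
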